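import Literature.Probability.Percolation.TriBoundaryZoneOrder
import HarnessLib

/-!
# Blocks of labels along the boundary traversal of the inner approximation

Topic `Literature/Probability/Percolation`; family `crit-perc`. Continuing `TriBoundaryZones.lean` and
`TriBoundaryZoneOrder.lean` (Bollobás–Riordan, *Percolation* (2006), Ch. 7 p. 191: "we are first close
to `Γ₁⁻`, then to `Γ₂⁻`, and so on"): **from a position labelled `i` whose tip is near the middle of
the arc `Aᵢ`, the next label met along the traversal is `i + 1`** (`IsLabel.exists_next`): the first
later position carrying a label other than `i` carries the label `i + 1`, and all positions strictly
in between carry no label other than `i`. The auxiliary middle position required by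
`IsLabel.next_eq_add_one` is the first later position whose tip is more than `60δ` away.

## References

* B. Bollobás, O. Riordan, *Percolation*, Cambridge University Press (2006), Ch. 7 §7.2.5 p. 191.

## Mathlib / tree

Mathlib: `Nat.find`. Tree: `TriBoundaryZoneOrder.lean` (`IsLabel.next_eq_add_one`), `TriBoundaryZones.lean`
(`exists_zone`, `dist_ztip_succ_le`, `dist_ztip_ztail_le`, `IsLabel.eq_of_succ`).
-/

noncomputable section

open Set Metric Literature.Topology.PlaneTopology Literature.Probability.LatticeModels Literature.Probability.RandomPlanarGeometry

namespace Literature.Probability.Percolation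

section Blocks

variable (R : ConformalRectangle) {δ : ℝ} (hδ : 0 < δ) {c₀ : Site 2} (hc₀ : c₀ ∈ innerCoarse R.carrier δ)

/-- **The next label after a mid-arc label `i` is `i + 1`.** Hypotheses: those of
`IsLabel.next_eq_add_one` on `R`, `ρ`, `δ` and the far point on `A_{i+2}`; a position `μ` labelled
`i` whose tip is within `ε'` of an interior point `x = ∂R(tm)` of `Aᵢ` at distance `≥ rm` from the
other arcs, with `ρ + ε' + 160δ < rm`; and some later position before `μ + #∂G` with a label other
than `i`. Conclusion: the first such position `c` is labelled `i + 1`, and strictly between `μ` and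
`c` no label other than `i` occurs. [cite: BollobasRiordan2006, Ch. 7 §7.2.5 p. 191] -/
theorem IsLabel.exists_next (hind : ∀ z ∈ R.carrier, R.index z = 1)
    {ρ η cpt carc : ℝ}
    (hη : ∀ q ∈ frontier R.carrier, ∀ i k : Fin 4, k ≠ i → infDist q (R.arc i) < η → infDist q (R.arc k) < η →
      ∃ m : Fin 4, (m = i ∨ m = i + 1) ∧ R.pt m ∈ R.arc k ∧ dist q (R.pt m) < ρ)
    (hδη : 48 * δ < η)
    (hcpt : ∀ m m' : Fin 4, m ≠ m' → cpt ≤ dist (R.pt m) (R.pt m')) (hρpt : 2 * ρ + 25 * δ < cpt)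
    (hcarc : ∀ (m i : Fin 4), R.pt m ∉ R.arc i → carc ≤ infDist (R.pt m) (R.arc i)) (hρarc : ρ + 25 * δ < carc)
    {i : Fin 4} {μ : ℕ} (hμ : IsLabel R hδ hc₀ μ i)
    -- the tip of `μ` is near an interior point of `Aᵢ`
    {tm rm ε' : ℝ} (htm : tm ∈ Ioo (R.mark i) (R.nextMark i))
    (hrm2 : ∀ k, k ≠ i → ∀ z ∈ R.arc k, rm ≤ dist z (R.boundary tm))
    (hμx : dist (ztip R hδ hc₀ μ) (R.boundary tm) < ε') (hsmall : ρ + ε' + 160 * δ < rm)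
    -- some later position with another label
    (hother : ∃ c, μ < c ∧ c < μ + (triBdryDarts (innerApprox R.toJordanDomain hδ hc₀).verts).card ∧ ∃ k, k ≠ i ∧ IsLabel R hδ hc₀ c k)
    -- the far point on `A_{i+2}`
    {tx r : ℝ} (htx : tx ∈ Ioo (R.mark (i + 2)) (R.nextMark (i + 2))) (hr : 0 < r)
    (hr2 : ∀ k, k ≠ i + 2 → ∀ z ∈ R.arc k, r ≤ dist z (R.boundary tx))
    (hρr : ρ + 25 * δ < r / 2)
    (hxF : ∃ F₀ : HexVertex, hexFaceVertices F₀ ⊆ (innerApprox R.toJordanDomain hδ hc₀).verts ∧ dist (meshCenter δ F₀) (R.boundary tx) < r / 2) :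
    ∃ c, μ < c ∧ c < μ + (triBdryDarts (innerApprox R.toJordanDomain hδ hc₀).verts).card ∧ IsLabel R hδ hc₀ c (i + 1) ∧
      (∀ b, μ < b → b < c → ∀ k, IsLabel R hδ hc₀ b k → k = i) ∧ ∃ m, IsCornerZone R hδ hc₀ ρ (c - 1) m := by
  classical
  set N := (triBdryDarts (innerApprox R.toJordanDomain hδ hc₀).verts).card with hN
  -- the first later position with another label
  have hex : ∃ c, μ < c ∧ ∃ k, k ≠ i ∧ IsLabel R hδ hc₀ c k := by
    obtain ⟨c, h1, -, h2⟩ := hother; exact ⟨c, h1, h2⟩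
  set c := Nat.find hex with hc
  obtain ⟨hμc, j, hji, hcj⟩ := Nat.find_spec hex
  have hmin : ∀ b, μ < b → b < c → ∀ k, IsLabel R hδ hc₀ b k → k = i := by
    intro b hμb hbc k hbk
    by_contra hki
    exact Nat.find_min hex hbc ⟨hμb, k, hki, hbk⟩
  have hcN : c < μ + N := by
    obtain ⟨c', h1, h2, h3⟩ := hother
    exact lt_of_le_of_lt (Nat.find_min' hex ⟨h1, h3⟩) h2
  -- `c - 1` is unlabelled (a label there would be `i`, consecutive with `j ≠ i`), hence in a corner zone
  have hcorner : ∃ m, IsCornerZone R hδ hc₀ ρ (c - 1) m := by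
    have hc1μ : μ ≤ c - 1 := by omega
    have hunl : ∀ k, ¬ IsLabel R hδ hc₀ (c - 1) k := by
      intro k hk
      have hki : k = i := by
        rcases hc1μ.eq_or_lt with h | h
        · rw [← h] at hk; exact hk.eq hμ
        · exact hmin (c - 1) h (by omega) k hk
      subst hki
      exact hji (hk.eq_of_succ (j := j) (by rwa [show c - 1 + 1 = c by omega])).symm
    rcases exists_zone (R := R) (hδ := hδ) (hc₀ := hc₀) hη hδη (c - 1) with ⟨k, hk⟩ | h
    · exact absurd hk (hunl k)
    · exact h
  refine ⟨c, hμc, hcN, ?_, hmin, hcorner⟩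
  -- the tip of `c` is far from the middle of `Aᵢ`
  have htipc : rm - ρ - 25 * δ ≤ dist (ztip R hδ hc₀ c) (R.boundary tm) := by
    obtain ⟨m, hm⟩ := hcorner
    · -- the corner `P_m` lies on an arc other than `Aᵢ`
      have hPm : rm ≤ dist (R.pt m) (R.boundary tm) := by
        by_cases hmi : m = i
        · have hmem : R.pt m ∈ R.arc (m + 3) :=
            R.pt_mem_arc_iff.2 (Or.inr (by rw [add_assoc, show (3 : Fin 4) + 1 = 0 by decide, add_zero]))
          exact hrm2 (m + 3) (by rw [hmi]; fin_cases i <;> decide) _ hmem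
        · exact hrm2 m hmi _ (R.pt_mem_arc_self m)
      have h1 := hm.2
      have h2 := dist_ztip_succ_le (R := R) (hδ := hδ) (hc₀ := hc₀) (c - 1)
      rw [show c - 1 + 1 = c by omega] at h2
      have := dist_triangle4 (R.pt m) (ztip R hδ hc₀ (c - 1)) (ztip R hδ hc₀ c) (R.boundary tm)
      rw [dist_comm] at h1
      linarith
  have hμc_far : rm - ρ - 25 * δ - ε' ≤ dist (ztip R hδ hc₀ c) (ztip R hδ hc₀ μ) := by
    have := dist_triangle (ztip R hδ hc₀ c) (ztip R hδ hc₀ μ) (R.boundary tm)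
    linarith
  -- the middle position: the first later position whose tip is more than `60δ` from the tip of `μ`
  have hex2 : ∃ n, μ < n ∧ 60 * δ < dist (ztip R hδ hc₀ n) (ztip R hδ hc₀ μ) := ⟨c, hμc, by linarith⟩
  set n₂ := Nat.find hex2 with hn₂
  obtain ⟨hμn₂, hn₂far⟩ := Nat.find_spec hex2
  have hn₂c : n₂ ≤ c := Nat.find_min' hex2 ⟨hμc, by linarith⟩
  have hn₂near : dist (ztip R hδ hc₀ n₂) (ztip R hδ hc₀ μ) ≤ 85 * δ := by
    have hprev : dist (ztip R hδ hc₀ (n₂ - 1)) (ztip R hδ hc₀ μ) ≤ 60 * δ := by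
      rcases Nat.lt_or_ge μ (n₂ - 1) with h | h
      · by_contra hlt
        exact Nat.find_min hex2 (show n₂ - 1 < n₂ by omega) ⟨h, not_le.1 hlt⟩
      · rw [show n₂ - 1 = μ by omega, dist_self]; positivity
    have h2 := dist_ztip_succ_le (R := R) (hδ := hδ) (hc₀ := hc₀) (n₂ - 1)
    rw [show n₂ - 1 + 1 = n₂ by omega] at h2
    have := dist_triangle (ztip R hδ hc₀ n₂) (ztip R hδ hc₀ (n₂ - 1)) (ztip R hδ hc₀ μ)
    rw [dist_comm] at h2
    linarith
  have hn₂c' : n₂ < c := by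
    rcases hn₂c.lt_or_eq with h | h
    · exact h
    · exfalso; rw [h] at hn₂near; linarith
  -- tail separations
  have htail : ∀ n, dist (ztip R hδ hc₀ n) (triMeshPoint δ (ztail R hδ hc₀ n)) ≤ 12 * δ := dist_ztip_ztail_le
  have d21 : 24 * δ < dist (triMeshPoint δ (ztail R hδ hc₀ n₂)) (triMeshPoint δ (ztail R hδ hc₀ μ)) := by
    have h1 := htail n₂; have h2 := htail μ
    have := dist_triangle4 (ztip R hδ hc₀ n₂) (triMeshPoint δ (ztail R hδ hc₀ n₂)) (triMeshPoint δ (ztail R hδ hc₀ μ)) (ztip R hδ hc₀ μ)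
    rw [dist_comm] at h2
    linarith
  have d23 : 24 * δ < dist (triMeshPoint δ (ztail R hδ hc₀ n₂)) (triMeshPoint δ (ztail R hδ hc₀ c)) := by
    have h1 := htail n₂; have h2 := htail c
    have h3 := dist_triangle4 (ztip R hδ hc₀ n₂) (triMeshPoint δ (ztail R hδ hc₀ n₂)) (triMeshPoint δ (ztail R hδ hc₀ c)) (ztip R hδ hc₀ c)
    have h4 := dist_triangle (ztip R hδ hc₀ c) (ztip R hδ hc₀ n₂) (ztip R hδ hc₀ μ)
    rw [dist_comm] at h2
    rw [dist_comm (ztip R hδ hc₀ c) (ztip R hδ hc₀ n₂)] at h4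
    linarith
  -- the order lemma
  have key := IsLabel.next_eq_add_one R hδ hc₀ hind hη hδη hcpt hρpt hcarc hρarc hμn₂ hn₂c' hcN hμ
    hcj hji hmin d21 d23 htx hr hr2 hρr hxF
  rw [← key]; exact hcj

/-- A copy of a position modulo `N` in the window `[lo, lo + N)`. [folklore] -/
theorem exists_copy_in_window {N : ℕ} (hN : 0 < N) (m lo : ℕ) : ∃ m', lo ≤ m' ∧ m' < lo + N ∧ m' % N = m % N := by
  refine ⟨lo + (m + N * lo - lo) % N, Nat.le_add_right _ _, by have := Nat.mod_lt (m + N * lo - lo) hN; omega, ?_⟩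
  have hle : lo ≤ m + N * lo := by nlinarith
  rw [Nat.add_mod, Nat.mod_mod, ← Nat.add_mod, show lo + (m + N * lo - lo) = m + N * lo by omega, Nat.add_mul_mod_self_left]

/-- **One step of the frame**: from the first position `prev` carrying the label `j ≠ 0` (no label
`j` in `[a₀, prev)`, `a₀ < prev < a₀ + #∂G` with `a₀` labelled `0`), the first position after `prev`
carrying a label other than `j` is labelled `j + 1` and lies at most at `a₀ + #∂G`. [cite: BollobasRiordan2006, Ch. 7 §7.2.5 p. 191] -/
theorem frame_step (hind : ∀ z ∈ R.carrier, R.index z = 1)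
    {ρ η cpt carc : ℝ}
    (hη : ∀ q ∈ frontier R.carrier, ∀ i k : Fin 4, k ≠ i → infDist q (R.arc i) < η → infDist q (R.arc k) < η →
      ∃ m : Fin 4, (m = i ∨ m = i + 1) ∧ R.pt m ∈ R.arc k ∧ dist q (R.pt m) < ρ)
    (hδη : 48 * δ < η)
    (hcpt : ∀ m m' : Fin 4, m ≠ m' → cpt ≤ dist (R.pt m) (R.pt m')) (hρpt : 2 * ρ + 25 * δ < cpt)
    (hcarc : ∀ (m i : Fin 4), R.pt m ∉ R.arc i → carc ≤ infDist (R.pt m) (R.arc i)) (hρarc : ρ + 25 * δ < carc)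
    {j : Fin 4} (hj0 : j ≠ 0) {μ : ℕ} (hμ : IsLabel R hδ hc₀ μ j)
    {tm rm ε' : ℝ} (htm : tm ∈ Ioo (R.mark j) (R.nextMark j))
    (hrm2 : ∀ k, k ≠ j → ∀ z ∈ R.arc k, rm ≤ dist z (R.boundary tm))
    (hμx : dist (ztip R hδ hc₀ μ) (R.boundary tm) < ε') (hsmall : ρ + ε' + 160 * δ < rm)
    {tx r : ℝ} (htx : tx ∈ Ioo (R.mark (j + 2)) (R.nextMark (j + 2))) (hr : 0 < r)
    (hr2 : ∀ k, k ≠ j + 2 → ∀ z ∈ R.arc k, r ≤ dist z (R.boundary tx))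
    (hρr : ρ + 25 * δ < r / 2)
    (hxF : ∃ F₀ : HexVertex, hexFaceVertices F₀ ⊆ (innerApprox R.toJordanDomain hδ hc₀).verts ∧ dist (meshCenter δ F₀) (R.boundary tx) < r / 2)
    {a₀ prev : ℕ} (ha₀ : IsLabel R hδ hc₀ a₀ 0) (hprev : IsLabel R hδ hc₀ prev j) (h0p : a₀ < prev)
    (hpN : prev < a₀ + (triBdryDarts (innerApprox R.toJordanDomain hδ hc₀).verts).card)
    (hnoj : ∀ b, a₀ ≤ b → b < prev → ¬ IsLabel R hδ hc₀ b j) :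
    ∃ c, prev < c ∧ c ≤ a₀ + (triBdryDarts (innerApprox R.toJordanDomain hδ hc₀).verts).card ∧ IsLabel R hδ hc₀ c (j + 1) ∧
      (∀ b, prev < b → b < c → ∀ k, IsLabel R hδ hc₀ b k → k = j) ∧ ∃ m, IsCornerZone R hδ hc₀ ρ (c - 1) m := by
  classical
  set N := (triBdryDarts (innerApprox R.toJordanDomain hδ hc₀).verts).card with hN
  have hN0 : 0 < N := (innerApprox R.toJordanDomain hδ hc₀).isTriDisc.card_pos
  have ha₀N : IsLabel R hδ hc₀ (a₀ + N) 0 := isLabel_add_card_iff.2 ha₀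
  -- the copy of `μ` in the window `[prev, prev + N)`
  obtain ⟨μ', hμ'1, hμ'2, hμ'mod⟩ := exists_copy_in_window hN0 μ prev
  have hμ' : IsLabel R hδ hc₀ μ' j := by
    rw [← isLabel_mod_iff, hμ'mod, isLabel_mod_iff]; exact hμ
  have hμ'x : dist (ztip R hδ hc₀ μ') (R.boundary tm) < ε' := by
    rw [← ztip_mod, hμ'mod, ztip_mod]; exact hμx
  -- `μ' < a₀ + N`: otherwise `μ' - N ∈ [a₀, prev)` would carry the label `j`
  have hμ'a : μ' < a₀ + N := by
    by_contra h
    push Not at h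
    have hlab : IsLabel R hδ hc₀ (μ' - N) j := by
      rw [← isLabel_add_card_iff, show μ' - N + N = μ' by omega]; exact hμ'
    exact hnoj (μ' - N) (by omega) (by omega) hlab
  -- the first position after `prev` with a label other than `j`
  have hex : ∃ c, prev < c ∧ ∃ k, k ≠ j ∧ IsLabel R hδ hc₀ c k := ⟨a₀ + N, hpN, 0, hj0.symm, ha₀N⟩
  set c' := Nat.find hex with hc'
  obtain ⟨hpc', k', hk'j, hc'k⟩ := Nat.find_spec hex
  have hc'min : ∀ b, prev < b → b < c' → ∀ k, IsLabel R hδ hc₀ b k → k = j := by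
    intro b hpb hbc k hbk
    by_contra hkj
    exact Nat.find_min hex hbc ⟨hpb, k, hkj, hbk⟩
  have hc'a : c' ≤ a₀ + N := Nat.find_min' hex ⟨hpN, 0, hj0.symm, ha₀N⟩
  -- `μ' < c'`: otherwise `prev, c', μ', a₀ + N` interleave
  have hμ'c' : μ' < c' := by
    by_contra h
    push Not at h
    have hne : c' ≠ μ' := fun e => hk'j ((show IsLabel R hδ hc₀ μ' k' by rw [← e]; exact hc'k).eq hμ')
    exact not_interleaved (R := R) (hδ := hδ) (hc₀ := hc₀) hpc' (lt_of_le_of_ne h hne) hμ'a (by omega) hprev (hc'k.isFar hk'j) hμ'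
      (ha₀N.isFar hj0.symm)
  -- the step lemma at `μ'`
  have hprevμ' : ∀ b, prev < b → b ≤ μ' → ∀ k, IsLabel R hδ hc₀ b k → k = j := fun b hpb hbμ k hbk =>
    hc'min b hpb (lt_of_le_of_lt hbμ hμ'c') k hbk
  obtain ⟨c, hμ'c, -, hcj1, hconly, hcorner⟩ := IsLabel.exists_next R hδ hc₀ hind hη hδη hcpt hρpt hcarc hρarc hμ' htm hrm2 hμ'x hsmall
    ⟨a₀ + N, hμ'a, by omega, 0, hj0.symm, ha₀N⟩ htx hr hr2 hρr hxF
  -- `c = c'`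
  have hcc' : c = c' := by
    apply le_antisymm
    · -- `c ≤ c'`: `c'` is after `μ'` with a label other than `j`
      by_contra h
      push Not at h
      exact hk'j (hconly c' hμ'c' h k' hc'k)
    · -- `c' ≤ c`: minimality of `c'`
      have hj1 : j + 1 ≠ j := by simp
      exact Nat.find_min' hex ⟨by omega, j + 1, hj1, hcj1⟩
  refine ⟨c, by omega, hcc' ▸ hc'a, hcj1, fun b hpb hbc k hbk => hc'min b hpb (hcc' ▸ hbc) k hbk, hcorner⟩

/-- **The frame of the four blocks.** Starting from a mid-arc position `a₀` labelled `0`, the first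
changes of label along the traversal occur at positions `c₀ < c₁ < c₂ < c₃ ≤ a₀ + #∂G`, to the labels
`1, 2, 3, 0` in this order, and between consecutive changes (and after the last one, up to `a₀ + #∂G`)
no other label occurs ("we are first close to `Γ₁⁻`, then to `Γ₂⁻`, and so on", B–R p. 191).
[cite: BollobasRiordan2006, Ch. 7 §7.2.5 p. 191] -/
theorem exists_frame (hind : ∀ z ∈ R.carrier, R.index z = 1)
    {ρ η cpt carc : ℝ}
    (hη : ∀ q ∈ frontier R.carrier, ∀ i k : Fin 4, k ≠ i → infDist q (R.arc i) < η → infDist q (R.arc k) < η →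
      ∃ m : Fin 4, (m = i ∨ m = i + 1) ∧ R.pt m ∈ R.arc k ∧ dist q (R.pt m) < ρ)
    (hδη : 48 * δ < η)
    (hcpt : ∀ m m' : Fin 4, m ≠ m' → cpt ≤ dist (R.pt m) (R.pt m')) (hρpt : 2 * ρ + 25 * δ < cpt)
    (hcarc : ∀ (m i : Fin 4), R.pt m ∉ R.arc i → carc ≤ infDist (R.pt m) (R.arc i)) (hρarc : ρ + 25 * δ < carc)
    {tm rm : Fin 4 → ℝ} {ε' : ℝ} (htm : ∀ i, tm i ∈ Ioo (R.mark i) (R.nextMark i))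
    (hrm2 : ∀ i k, k ≠ i → ∀ z ∈ R.arc k, rm i ≤ dist z (R.boundary (tm i)))
    (hrm0 : ∀ i, 0 < rm i) (hsmall : ∀ i, ρ + ε' + 160 * δ < rm i) (hρr : ∀ i, ρ + 25 * δ < rm i / 2)
    (hxF : ∀ i, ∃ F₀ : HexVertex, hexFaceVertices F₀ ⊆ (innerApprox R.toJordanDomain hδ hc₀).verts ∧
      dist (meshCenter δ F₀) (R.boundary (tm i)) < rm i / 2)
    {μ : Fin 4 → ℕ} (hμ : ∀ i, IsLabel R hδ hc₀ (μ i) i) (hμx : ∀ i, dist (ztip R hδ hc₀ (μ i)) (R.boundary (tm i)) < ε') :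
    ∃ c₀ c₁ c₂ c₃ : ℕ, μ 0 < c₀ ∧ c₀ < c₁ ∧ c₁ < c₂ ∧ c₂ < c₃ ∧ c₃ ≤ μ 0 + (triBdryDarts (innerApprox R.toJordanDomain hδ hc₀).verts).card ∧
      IsLabel R hδ hc₀ c₀ 1 ∧ IsLabel R hδ hc₀ c₁ 2 ∧ IsLabel R hδ hc₀ c₂ 3 ∧ IsLabel R hδ hc₀ c₃ 0 ∧
      (∀ b, μ 0 < b → b < c₀ → ∀ k, IsLabel R hδ hc₀ b k → k = 0) ∧
      (∀ b, c₀ < b → b < c₁ → ∀ k, IsLabel R hδ hc₀ b k → k = 1) ∧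
      (∀ b, c₁ < b → b < c₂ → ∀ k, IsLabel R hδ hc₀ b k → k = 2) ∧
      (∀ b, c₂ < b → b < c₃ → ∀ k, IsLabel R hδ hc₀ b k → k = 3) ∧
      (∀ b, c₃ < b → b < μ 0 + (triBdryDarts (innerApprox R.toJordanDomain hδ hc₀).verts).card → ∀ k, IsLabel R hδ hc₀ b k → k = 0) ∧
      (∃ m, IsCornerZone R hδ hc₀ ρ (c₀ - 1) m) ∧ (∃ m, IsCornerZone R hδ hc₀ ρ (c₁ - 1) m) ∧
      (∃ m, IsCornerZone R hδ hc₀ ρ (c₂ - 1) m) ∧ (∃ m, IsCornerZone R hδ hc₀ ρ (c₃ - 1) m) := by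
  classical
  set N := (triBdryDarts (innerApprox R.toJordanDomain hδ hc₀).verts).card with hN
  have hN0 : 0 < N := (innerApprox R.toJordanDomain hδ hc₀).isTriDisc.card_pos
  set a₀ := μ 0 with ha₀
  have ha₀l : IsLabel R hδ hc₀ a₀ 0 := hμ 0
  have ha₀N : IsLabel R hδ hc₀ (a₀ + N) 0 := isLabel_add_card_iff.2 ha₀l
  -- step 0: a position after `a₀` with another label: the copy of `μ 1` in `(a₀, a₀ + N]`
  have hother0 : ∃ c, a₀ < c ∧ c < a₀ + N ∧ ∃ k, k ≠ (0 : Fin 4) ∧ IsLabel R hδ hc₀ c k := by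
    obtain ⟨m', h1, h2, hmod⟩ := exists_copy_in_window hN0 (μ 1) (a₀ + 1)
    have hm' : IsLabel R hδ hc₀ m' 1 := by rw [← isLabel_mod_iff, hmod, isLabel_mod_iff]; exact hμ 1
    refine ⟨m', by omega, ?_, 1, by decide, hm'⟩
    rcases Nat.lt_or_ge m' (a₀ + N) with h | h
    · exact h
    · exfalso
      have : m' = a₀ + N := by omega
      rw [this] at hm'
      exact absurd (hm'.eq ha₀N) (by decide)
  obtain ⟨c₀', h0c₀, hc₀N, hc₀1, honly0, hcz0⟩ := IsLabel.exists_next R hδ hc₀ hind hη hδη hcpt hρpt hcarc hρarc (hμ 0) (htm 0) (hrm2 0)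
    (hμx 0) (hsmall 0) hother0 (by simpa using htm (0 + 2)) (hrm0 2) (by simpa using hrm2 (0 + 2)) (by simpa using hρr 2)
    (by simpa using hxF 2)
  -- step 1
  obtain ⟨c₁', h01, hc₁N, hc₁2, honly1, hcz1⟩ := frame_step R hδ hc₀ hind hη hδη hcpt hρpt hcarc hρarc (j := 1) (by decide) (hμ 1) (htm 1)
    (hrm2 1) (hμx 1) (hsmall 1) (by simpa using htm (1 + 2)) (hrm0 3) (by simpa using hrm2 (1 + 2)) (by simpa using hρr 3)
    (by simpa using hxF 3) ha₀l hc₀1 h0c₀ hc₀N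
    (fun b hab hbc hb1 => by
      rcases hab.eq_or_lt with h | h
      · rw [← h] at hb1; exact absurd (hb1.eq ha₀l) (by decide)
      · exact absurd (honly0 b h hbc 1 hb1) (by decide))
  -- step 2
  have hc₁N' : c₁' < a₀ + N := by
    rcases hc₁N.lt_or_eq with h | h
    · exact h
    · exfalso; rw [h] at hc₁2; exact absurd (hc₁2.eq ha₀N) (by decide)
  obtain ⟨c₂', h12, hc₂N, hc₂3, honly2, hcz2⟩ := frame_step R hδ hc₀ hind hη hδη hcpt hρpt hcarc hρarc (j := 2) (by decide) (hμ 2) (htm 2)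
    (hrm2 2) (hμx 2) (hsmall 2) (by simpa using htm (2 + 2)) (hrm0 0) (by simpa using hrm2 (2 + 2)) (by simpa using hρr 0)
    (by simpa using hxF 0) ha₀l (by simpa using hc₁2) (by omega) hc₁N'
    (fun b hab hbc hb2 => by
      rcases hab.eq_or_lt with h | h
      · rw [← h] at hb2; exact absurd (hb2.eq ha₀l) (by decide)
      rcases Nat.lt_trichotomy b c₀' with h' | h' | h'
      · exact absurd (honly0 b h h' 2 hb2) (by decide)
      · rw [h'] at hb2; exact absurd (hb2.eq hc₀1) (by decide)
      · exact absurd (honly1 b h' hbc 2 hb2) (by decide))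
  -- step 3
  have hc₂N' : c₂' < a₀ + N := by
    rcases hc₂N.lt_or_eq with h | h
    · exact h
    · exfalso; rw [h] at hc₂3; exact absurd (hc₂3.eq ha₀N) (by decide)
  obtain ⟨c₃', h23, hc₃N, hc₃0, honly3, hcz3⟩ := frame_step R hδ hc₀ hind hη hδη hcpt hρpt hcarc hρarc (j := 3) (by decide) (hμ 3) (htm 3)
    (hrm2 3) (hμx 3) (hsmall 3) (by simpa using htm (3 + 2)) (hrm0 1) (by simpa using hrm2 (3 + 2)) (by simpa using hρr 1)
    (by simpa using hxF 1) ha₀l (by simpa using hc₂3) (by omega) hc₂N'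
    (fun b hab hbc hb3 => by
      rcases hab.eq_or_lt with h | h
      · rw [← h] at hb3; exact absurd (hb3.eq ha₀l) (by decide)
      rcases Nat.lt_trichotomy b c₀' with h' | h' | h'
      · exact absurd (honly0 b h h' 3 hb3) (by decide)
      · rw [h'] at hb3; exact absurd (hb3.eq hc₀1) (by decide)
      rcases Nat.lt_trichotomy b c₁' with h'' | h'' | h''
      · exact absurd (honly1 b h' h'' 3 hb3) (by decide)
      · rw [h''] at hb3; exact absurd (hb3.eq hc₁2) (by decide)
      · exact absurd (honly2 b h'' hbc 3 hb3) (by decide))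
  -- after `c₃`: only the label `0`, by no interleaving with `c₀ + N`
  have hc₀N1 : IsLabel R hδ hc₀ (c₀' + N) 1 := isLabel_add_card_iff.2 hc₀1
  refine ⟨c₀', c₁', c₂', c₃', h0c₀, h01, h12, h23, hc₃N, hc₀1, hc₁2, hc₂3, by simpa using hc₃0, honly0, honly1, honly2, honly3,
    fun b h3b hbN k hbk => ?_, hcz0, hcz1, hcz2, hcz3⟩
  by_contra hk0
  have hb : IsFar R hδ hc₀ b 0 := hbk.isFar hk0
  exact not_interleaved (R := R) (hδ := hδ) (hc₀ := hc₀) h3b hbN (by omega) (by show c₀' + N < c₃' + N; omega) (by simpa using hc₃0) hb ha₀N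
    (hc₀N1.isFar (by decide))

end Blocks

end Literature.Probability.Percolation

namespace Literature.Probability.Percolation

section BlockData

variable (R : ConformalRectangle) {δ : ℝ} (hδ : 0 < δ) {c₀ : Site 2} (hc₀ : c₀ ∈ innerCoarse R.carrier δ)

/-- **The last position labelled `i` in a block, and the corner zone after it.** In a window
`[e, e')` with `e` labelled `i`, `e'` labelled `i + 1`, `e' ≤ e + #∂G`… more precisely `e' < e + #∂G`,
only the label `i` inside, and a corner zone just before `e'`: the last position `l` labelled `i`
satisfies `l < e'`, and every position strictly between `l` and `e'` is in the corner zone `i + 1`.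
[folklore] -/
theorem exists_last_label {ρ cpt carc : ℝ}
    (hcpt : ∀ m m' : Fin 4, m ≠ m' → cpt ≤ dist (R.pt m) (R.pt m')) (hρpt : 2 * ρ + 25 * δ < cpt)
    (hcarc : ∀ (m i : Fin 4), R.pt m ∉ R.arc i → carc ≤ infDist (R.pt m) (R.arc i)) (hρarc : ρ + 25 * δ < carc)
    {η : ℝ} (hη : ∀ q ∈ frontier R.carrier, ∀ i k : Fin 4, k ≠ i → infDist q (R.arc i) < η → infDist q (R.arc k) < η →
      ∃ m : Fin 4, (m = i ∨ m = i + 1) ∧ R.pt m ∈ R.arc k ∧ dist q (R.pt m) < ρ) (hδη : 48 * δ < η)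
    {i : Fin 4} {e e' : ℕ} (hee' : e < e') (he : IsLabel R hδ hc₀ e i) (he' : IsLabel R hδ hc₀ e' (i + 1))
    (honly : ∀ b, e ≤ b → b < e' → ∀ k, IsLabel R hδ hc₀ b k → k = i) (hcz : ∃ m, IsCornerZone R hδ hc₀ ρ (e' - 1) m) :
    ∃ l, e ≤ l ∧ l < e' ∧ IsLabel R hδ hc₀ l i ∧ ∀ b, l < b → b < e' → IsCornerZone R hδ hc₀ ρ b (i + 1) := by
  classical
  set S := (Finset.range e').filter fun b => e ≤ b ∧ IsLabel R hδ hc₀ b i with hS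
  have hSne : S.Nonempty := ⟨e, Finset.mem_filter.2 ⟨Finset.mem_range.2 hee', le_rfl, he⟩⟩
  obtain ⟨l, hlS, hmax⟩ := S.exists_max_image id hSne
  obtain ⟨hle', hel, hli⟩ := Finset.mem_filter.1 hlS
  have hle'' : l < e' := Finset.mem_range.1 hle'
  have hlast : ∀ b, l < b → b < e' → ∀ k, ¬ IsLabel R hδ hc₀ b k := by
    intro b hlb hbe k hbk
    have hki := honly b (by omega) hbe k hbk
    subst hki
    have := hmax b (Finset.mem_filter.2 ⟨Finset.mem_range.2 hbe, by omega, hbk⟩)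
    simp only [id] at this
    omega
  -- the corner zone just before `e'` is `i + 1` (adjacent to the label `i + 1` at `e'` and, through the gap, to the label `i` at `l`)
  obtain ⟨m, hm⟩ := hcz
  have hl1 : l + 1 < e' ∨ l + 1 = e' := by omega
  rcases hl1 with hl1 | hl1
  swap
  · exfalso
    exact absurd (hli.eq_of_succ (hl1 ▸ he')) (by simp)
  -- all positions in `(l, e')` are in the corner zone `m`
  have hzone : ∀ b, l < b → b < e' → ∃ m', IsCornerZone R hδ hc₀ ρ b m' := fun b hlb hbe => by
    rcases exists_zone (R := R) (hδ := hδ) (hc₀ := hc₀) hη hδη b with ⟨k, hk⟩ | h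
    · exact absurd hk (hlast b hlb hbe k)
    · exact h
  have hall : ∀ b, l < b → b < e' → IsCornerZone R hδ hc₀ ρ b m := by
    -- downward from `e' - 1`
    intro b hlb hbe
    obtain ⟨d, rfl⟩ : ∃ d, b = e' - 1 - d := ⟨e' - 1 - b, by omega⟩
    induction d with
    | zero => simpa using hm
    | succ d ih =>
      have hb' := ih (by omega) (by omega)
      obtain ⟨m', hm'⟩ := hzone (e' - 1 - (d + 1)) hlb hbe
      have := IsCornerZone.eq_of_succ hcpt hρpt hm' (by rwa [show e' - 1 - (d + 1) + 1 = e' - 1 - d by omega])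
      rwa [← this]
  have hm_succ : m = i + 1 ∨ m = i + 1 + 1 := by
    have h1 : IsCornerZone R hδ hc₀ ρ (e' - 1) m := hall (e' - 1) (by omega) (by omega)
    exact h1.label_succ hcarc hρarc (i := i + 1) (by rwa [show e' - 1 + 1 = e' by omega])
  have hm_i : m = i ∨ m = i + 1 := hli.corner_succ hcarc hρarc (hall (l + 1) (by omega) hl1)
  have hm : m = i + 1 := by
    rcases hm_i with h | h
    · rcases hm_succ with h' | h'
      · exact h'
      · exfalso; rw [h] at h'; exact absurd h' (by fin_cases i <;> decide)
    · exact h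
  subst hm
  exact ⟨l, hel, hle'', hli, hall⟩

end BlockData

end Literature.Probability.Percolation
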